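/-
Copyright (c) 2026 the pub-hodgecm-mathlib formalisation cell (harness21).  Prover seat hodgecm-mathlib-K2Liu-p23 (g3), Track B «K2-LIT»,
#184♮ = hLiu418 = `stmt-HodgeConjecture-24832`; socket #42S block D, the (σ-A) MINI-ROAD (RULING M-160f, LEAD F0P6-plan (g15) BATCH #227∕#232),
brick [A2] «PARTIAL FOURIER + PRODUCT SPLITTING» ((σ-A) road desk K2Liu-p25 (g3); consumers [A1] K2Liu-p09 (g9), [A3] LH4-p07 (g12), [A4] K2Liu-p25).
KERNEL: theorems only.
-/
import Literature.RepresentationTheory.HeisenbergGroup.SchwartzBruhatLatticeUncertaintyBox   -- ★ `boxEquivSB_refl_apply`, ★ slice formula `coe_sumEndSB_id_apply_glue`, `boxEquivSB`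
import Literature.RepresentationTheory.HeisenbergGroup.SchrodingerPiOperators                -- ★ Rao `fourierOpPi μ hψ hm = piFourierEquivSB (Measure.pi fun _ => μ) hψ hm`, `coe_fourierOpPi`
import Literature.RepresentationTheory.HeisenbergGroup.SchwartzBruhatDualFamily               -- ★ `continuous_schwartzBruhat`, `hasCompactSupport_schwartzBruhat`
import HarnessLib

/-!
# Crux `HLiu418`, socket #42S block D, (σ-A) brick [A2]: THE PARTIAL FOURIER TRANSFORM ALONG A COORDINATE SPLITTING `e : ι₁ ⊕ ι₂ ≃ ι`, READ
# POINTWISE, AND FUBINI ∕ PRODUCT SPLITTING OF `∫_{K^ι}` ALONG `glue e`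

Cell `hodgecm-mathlib`, crux item hLiu418 = `stmt-HodgeConjecture-24832` (helper lane `--supports stmt-HodgeConjecture-24832 --as helper`, count-neutral; closes
no socket); (σ-A) mini-road of RULING M-160f ([A1] corner action words · [A2] THIS FILE · [A3] the two stage integrals at `s₀ = ½` · [A4] pure-tensor reduction + line
word).  THEOREMS ONLY (no `def`, no `instance`, no `notation`, no named-fact hypothesis, no `sorry`).  Generic: `K` a non-archimedean local field, finite index
types with a splitting `e : ι₁ ⊕ ι₂ ≃ ι` (at the instances of record `e := finSumFinEquiv : Fin 6 ⊕ Fin 6 ≃ Fin 12` — the `e₂`-block of the rank-2 Schrödinger model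
`𝒮(L⁺_v^{12})` — and `Fin 4 ⊕ Fin 8 ≃ Fin 12` — `V′_v = V₁ ⊕ H`), one additive Haar measure `μ` on `K` and the product measures `μ^{⊗ι₁}`, `μ^{⊗ι₂}`, `μ^{⊗ι}` (Rao's
currency, ★ `SchrodingerPiOperators.fourierOpPi`).

WHAT IS ★ ALREADY (by name — not re-typed here): the coordinates `glue e a b = a ⊔ b`, `resL`, `resR` and the pure-tensor structure `𝒮(K^ι) = 𝒮(K^{ι₁}) ⊗ 𝒮(K^{ι₂})`
(★ `LocalSchwartzBruhatDirectSum`: `sumEquivSB`, `boxSB` = `f₁ ⊠ f₂`, `coe_boxSB`, `linearMap_ext_boxSB`, `range_sumMapSB`, `sumEndSB B₁ B₂`); the product operator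
`M₁ ⊠ M₂ = boxEquivSB K e M₁ M₂` (★ `DoubledDeltaDoublingIdentity`) with `(M ⊠ 1) f = sumEndSB K e M id f` (★ `boxEquivSB_refl_apply`); THE PARTIAL FOURIER OPERATOR of
the `ι₁`-block `𝓕 ⊠ 1 := boxEquivSB K e (fourierOpPi μ hψ hm) (LinearEquiv.refl ℂ _)` — no new definition is needed — and its Weil meaning ★
`SchrodingerPartialFourierWeyl.implements_partialWeyl_boxFourier` («`𝓕_{x′} ⊠ 1` IMPLEMENTS the partial Weyl element of the `ι₁`-block for ANY Gram matrix, in dual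
coordinates»); THE SLICE FORMULA ★ `SchwartzBruhatLatticeUncertainty.coe_sumEndSB_id_apply_glue` (`((B ⊠ 1) f)(a ⊔ b) = (B (x′ ↦ f(x′ ⊔ b)))(a)` for every linear `B`).
WHAT THIS FILE ADDS:
* §1 SWAP OF THE FACTORS: `glue_sumComm`, `boxSB_sumComm`, `sumEndSB_sumComm` — `B₁ ⊠_e B₂ = B₂ ⊠_{e ∘ swap} B₁`; hence the RIGHT-slot slice formula
  **`coe_sumEndSB_id_left_apply_glue`**: `((1 ⊠ B) f)(a ⊔ b) = (B (y ↦ f(a ⊔ y)))(b)`.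
* §2 THE PARTIAL FOURIER TRANSFORMS READ POINTWISE: **`coe_boxEquivSB_fourierOpPi_refl_apply_glue`** — `((𝓕 ⊠ 1) Θ)(η ⊔ b) = ∫ ψ(u ⬝ᵥ η) Θ(u ⊔ b) dμ^{⊗ι₁}(u)` for EVERY
  `Θ ∈ 𝒮(K^ι)`, and **`coe_boxEquivSB_refl_fourierOpPi_apply_glue`** — `((1 ⊠ 𝓕) Θ)(a ⊔ η) = ∫ ψ(u ⬝ᵥ η) Θ(a ⊔ u) dμ^{⊗ι₂}(u)`; the same for an abstract Haar measure on the
  block (`…piFourierEquivSB…`); on products `(𝓕 ⊠ 1)(f₁ ⊠ f₂) = 𝓕f₁ ⊠ f₂` is ★ `boxEquivSB_boxSB`.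
* §3 FUBINI ALONG THE SPLITTING: **`measurePreserving_glue`** — `(a, b) ↦ a ⊔ b` carries `μ^{⊗ι₁} × μ^{⊗ι₂}` to `μ^{⊗ι}` (Mathlib `measurePreserving_piCongrLeft` ∘
  `measurePreserving_sumPiEquivProdPi_symm`); **`integral_comp_glue`** — `∫_{K^ι} F = ∫_{K^{ι₁} × K^{ι₂}} F(a ⊔ b)` for EVERY `F` (no integrability needed);
  `integrable_comp_glue_iff`; **`integral_eq_integral_integral_glue`** ∕ `…_symm` — the two iterated orders for integrable `F`; the hypothesis-free Schwartz–Bruhat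
  instances `integrable_schwartzBruhat_pi`, **`integral_schwartzBruhat_eq_integral_integral_glue`**; and the PRODUCT SPLITTING **`integral_boxSB`** —
  `∫ (f₁ ⊠ f₂) dμ^{⊗ι} = (∫ f₁ dμ^{⊗ι₁}) · (∫ f₂ dμ^{⊗ι₂})` ([A4]'s `Φ_v = φ₁ ⊠ φ₂` along `Fin 4 ⊕ Fin 8`).
* §5 TRANSVERSAL COMPATIBILITY ((σ-A) desk WORD #1 (c)): `glue_glue_eq_glue_glue` (the four-block identity), `glue_dotProduct_glue`, and
  **`boxEquivSB_fourierOpPi_refl_boxSB_of_fourBlock`** — for a Fourier block `ι₁ = α₁ ⊔ β₁` and box factors `τ₁ = α₁ ⊔ α₂`, `τ₂ = β₁ ⊔ β₂` refining a common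
  four-block decomposition of `ι`: `(𝓕_{ι₁} ⊠_e 1)(φ₁ ⊠_τ φ₂) = ((𝓕_{α₁} ⊠ 1) φ₁) ⊠_τ ((𝓕_{β₁} ⊠ 1) φ₂)` — the pure-tensor reduction commutes with the `e₂`-block word.
References: [WeilBNT1967] Chap. VII §2 Prop. 2 (standard functions on a product; Fourier transforms factor by factor); [MoeglinVignerasWaldspurger1987] Chap. 2 II.1
Rem. (6), II.6 (partial Fourier transforms in the Schrödinger model); [Rangarao1993] §3.1 (3.9) (the operators `r(τ_S)` for a subset `S` of the coordinates).
HONEST LABEL.  Count-neutral helper: `HC_CM` is proved only modulo the 7 printed citations (2 remaining named inputs: hLiu418 = `stmt-HodgeConjecture-24832`,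
h413 = `stmt-HodgeConjecture-24833`) until rung 0 closes; this file closes no socket and asserts nothing about the corner words ([A1]) or the stage integrals ([A3]).
-/

set_option autoImplicit false
set_option linter.dupNamespace false -- the mandated namespace repeats `HodgeConjecture.HodgeConjecture`

noncomputable section

open MeasureTheory
open Literature.NumberTheory.Automorphic
open Literature.NumberTheory.GaloisRepresentations.IsNonarchimedeanLocalField
open Literature.RepresentationTheory.HeisenbergGroup

namespace Summit.HodgeConjecture.HodgeConjecture.Cruxes.HLiu418.K2LiuLocalPiPartialFourierSplitting

/-! ## §1 Swap of the two factors; the right-slot slice formula -/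

section Swap

variable {X : Type*} {ι₁ ι₂ ι : Type*} (e : ι₁ ⊕ ι₂ ≃ ι)

/-- gluing along the swapped splitting `e ∘ swap : ι₂ ⊕ ι₁ ≃ ι` is gluing along `e` with the arguments exchanged: `b ⊔_{e∘swap} a = a ⊔_e b`. [folklore] -/
theorem glue_sumComm (a : ι₁ → X) (b : ι₂ → X) : glue ((Equiv.sumComm ι₂ ι₁).trans e) b a = glue e a b := by
  funext k
  simp only [glue, Equiv.symm_trans_apply, Equiv.sumComm_symm, Equiv.sumComm_apply]
  cases e.symm k <;> rfl

/-- `resL` along the swapped splitting is `resR`. [folklore] -/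
theorem resL_sumComm (v : ι → X) : resL ((Equiv.sumComm ι₂ ι₁).trans e) v = resR e v := rfl

/-- `resR` along the swapped splitting is `resL`. [folklore] -/
theorem resR_sumComm (v : ι → X) : resR ((Equiv.sumComm ι₂ ι₁).trans e) v = resL e v := rfl

end Swap

section SwapSB

variable (K : Type*) [Field K] [ValuativeRel K] [TopologicalSpace K] [IsNonarchimedeanLocalField K]
  {ι₁ ι₂ ι : Type*} [Fintype ι₁] [Fintype ι₂] [Fintype ι] (e : ι₁ ⊕ ι₂ ≃ ι)

/-- **SWAP OF THE FACTORS ON PRODUCTS**: `f₂ ⊠_{e∘swap} f₁ = f₁ ⊠_e f₂`. [cite: WeilBNT1967, Chap. VII §2, Prop. 2] -/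
theorem boxSB_sumComm (f₁ : SchwartzBruhat (ι₁ → K)) (f₂ : SchwartzBruhat (ι₂ → K)) :
    boxSB K ((Equiv.sumComm ι₂ ι₁).trans e) f₂ f₁ = boxSB K e f₁ f₂ := by
  apply Subtype.ext
  rw [coe_boxSB, coe_boxSB]
  funext v
  rw [resL_sumComm, resR_sumComm, mul_comm]

/-- **SWAP OF THE FACTORS ON PRODUCT OPERATORS**: `B₂ ⊠_{e∘swap} B₁ = B₁ ⊠_e B₂` (both sides agree on every `f₁ ⊠_e f₂ = f₂ ⊠_{e∘swap} f₁`, which span).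
[cite: MoeglinVignerasWaldspurger1987, Chap. 2 II.1 Rem. (6)] -/
theorem sumEndSB_sumComm (B₁ : SchwartzBruhat (ι₁ → K) →ₗ[ℂ] SchwartzBruhat (ι₁ → K))
    (B₂ : SchwartzBruhat (ι₂ → K) →ₗ[ℂ] SchwartzBruhat (ι₂ → K)) :
    sumEndSB K ((Equiv.sumComm ι₂ ι₁).trans e) B₂ B₁ = sumEndSB K e B₁ B₂ :=
  linearMap_ext_boxSB K e fun f₁ f₂ => by
    rw [sumEndSB_boxSB, ← boxSB_sumComm K e f₁ f₂, sumEndSB_boxSB, boxSB_sumComm]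

omit [Field K] [ValuativeRel K] [IsNonarchimedeanLocalField K] [Fintype ι₁] [Fintype ι₂] [Fintype ι] in
/-- a slice `y ↦ f(a ⊔ y)` of a Schwartz–Bruhat function on `K^ι` is Schwartz–Bruhat on `K^{ι₂}` (★ `sliceL_mem_schwartzBruhat` along the swapped splitting).
[cite: WeilBNT1967, Chap. VII §2, Def. 1] -/
theorem sliceR_mem_schwartzBruhat {f : (ι → K) → ℂ} (hf : f ∈ SchwartzBruhat (ι → K)) (a : ι₁ → K) :
    (fun y : ι₂ → K => f (glue e a y)) ∈ SchwartzBruhat (ι₂ → K) := by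
  have h := sliceL_mem_schwartzBruhat ((Equiv.sumComm ι₂ ι₁).trans e) hf a
  simp only [glue_sumComm] at h
  exact h

/-- **THE RIGHT-SLOT SLICE FORMULA**: `((1 ⊠ B) f)(a ⊔ b) = (B (y ↦ f(a ⊔ y)))(b)` for every linear endomorphism `B` of `𝒮(K^{ι₂})` (★ left-slot slice formula
along the swapped splitting + §1). [cite: MoeglinVignerasWaldspurger1987, Chap. 2 II.1 Rem. (6)] -/
theorem coe_sumEndSB_id_left_apply_glue (B : SchwartzBruhat (ι₂ → K) →ₗ[ℂ] SchwartzBruhat (ι₂ → K))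
    (f : SchwartzBruhat (ι → K)) (a : ι₁ → K) (b : ι₂ → K) :
    ((sumEndSB K e LinearMap.id B f : SchwartzBruhat (ι → K)) : (ι → K) → ℂ) (glue e a b) =
      ((B ⟨fun y => (f : (ι → K) → ℂ) (glue e a y), sliceR_mem_schwartzBruhat K e f.2 a⟩ : SchwartzBruhat (ι₂ → K)) :
        (ι₂ → K) → ℂ) b := by
  have hs : (⟨fun x' => (f : (ι → K) → ℂ) (glue ((Equiv.sumComm ι₂ ι₁).trans e) x' a),
        sliceL_mem_schwartzBruhat ((Equiv.sumComm ι₂ ι₁).trans e) f.2 a⟩ : SchwartzBruhat (ι₂ → K)) =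
      ⟨fun y => (f : (ι → K) → ℂ) (glue e a y), sliceR_mem_schwartzBruhat K e f.2 a⟩ :=
    Subtype.ext (funext fun y => by simp only [glue_sumComm])
  rw [← sumEndSB_sumComm K e LinearMap.id B, ← glue_sumComm e a b, coe_sumEndSB_id_apply_glue, hs]

end SwapSB

/-! ## §2 The partial Fourier transforms `𝓕 ⊠ 1`, `1 ⊠ 𝓕` read pointwise -/

section PartialFourier

variable (K : Type*) [Field K] [ValuativeRel K] [TopologicalSpace K] [IsNonarchimedeanLocalField K]
  {ι₁ ι₂ ι : Type*} [Fintype ι₁] [Fintype ι₂] [Fintype ι] (e : ι₁ ⊕ ι₂ ≃ ι)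
  {ψ : AddChar K Circle} (hψ : ψ.IsContinuousNontrivial) {m : ℤ} (hm : ψ.HasConductorExp m)

/-- **`𝓕 ⊠ 1` READ POINTWISE (abstract Haar measure `μ₁` on the block)**: `((𝓕_{μ₁} ⊠ 1) Θ)(η ⊔ b) = ∫ ψ(u ⬝ᵥ η) Θ(u ⊔ b) dμ₁(u)` for every `Θ ∈ 𝒮(K^ι)`
(★ slice formula at `B := piFourierEquivSB μ₁ hψ hm` + ★ `coe_piFourierEquivSB`). [cite: MoeglinVignerasWaldspurger1987, Chap. 2 II.6] [cite: WeilBNT1967, Chap. VII §2, Prop. 2] -/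
theorem coe_boxEquivSB_piFourier_refl_apply_glue [MeasurableSpace (ι₁ → K)] [BorelSpace (ι₁ → K)] (μ₁ : Measure (ι₁ → K)) [μ₁.IsAddHaarMeasure]
    (Θ : SchwartzBruhat (ι → K)) (η : ι₁ → K) (b : ι₂ → K) :
    ((boxEquivSB K e (piFourierEquivSB μ₁ hψ hm) (LinearEquiv.refl ℂ (SchwartzBruhat (ι₂ → K))) Θ : SchwartzBruhat (ι → K)) : (ι → K) → ℂ) (glue e η b) =
      ∫ u, ((ψ (u ⬝ᵥ η) : Circle) : ℂ) * (Θ : (ι → K) → ℂ) (glue e u b) ∂μ₁ := by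
  rw [boxEquivSB_refl_apply, coe_sumEndSB_id_apply_glue, LinearEquiv.coe_coe, coe_piFourierEquivSB, piFourierSB_apply]

/-- **`1 ⊠ 𝓕` READ POINTWISE (abstract Haar measure `μ₂` on the block)**: `((1 ⊠ 𝓕_{μ₂}) Θ)(a ⊔ η) = ∫ ψ(u ⬝ᵥ η) Θ(a ⊔ u) dμ₂(u)`.
[cite: MoeglinVignerasWaldspurger1987, Chap. 2 II.6] [cite: WeilBNT1967, Chap. VII §2, Prop. 2] -/
theorem coe_boxEquivSB_refl_piFourier_apply_glue [MeasurableSpace (ι₂ → K)] [BorelSpace (ι₂ → K)] (μ₂ : Measure (ι₂ → K)) [μ₂.IsAddHaarMeasure]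
    (Θ : SchwartzBruhat (ι → K)) (a : ι₁ → K) (η : ι₂ → K) :
    ((boxEquivSB K e (LinearEquiv.refl ℂ (SchwartzBruhat (ι₁ → K))) (piFourierEquivSB μ₂ hψ hm) Θ : SchwartzBruhat (ι → K)) : (ι → K) → ℂ) (glue e a η) =
      ∫ u, ((ψ (u ⬝ᵥ η) : Circle) : ℂ) * (Θ : (ι → K) → ℂ) (glue e a u) ∂μ₂ := by
  rw [← LinearEquiv.coe_coe, coe_boxEquivSB_eq_sumEndSB]
  rw [show ((LinearEquiv.refl ℂ (SchwartzBruhat (ι₁ → K)) : SchwartzBruhat (ι₁ → K) →ₗ[ℂ] SchwartzBruhat (ι₁ → K))) = LinearMap.id from rfl,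
    coe_sumEndSB_id_left_apply_glue, LinearEquiv.coe_coe, coe_piFourierEquivSB, piFourierSB_apply]

variable [MeasurableSpace K] [BorelSpace K] (μ : Measure K) [μ.IsAddHaarMeasure]

/-- **THE PARTIAL FOURIER TRANSFORM OF THE `ι₁`-BLOCK READ POINTWISE (Rao's product measure)**: for every `Θ ∈ 𝒮(K^ι)`,
`((fourierOpPi μ ⊠ 1) Θ)(η ⊔ b) = ∫ ψ(u ⬝ᵥ η) Θ(u ⊔ b) dμ^{⊗ι₁}(u)` — the operator ★ `implements_partialWeyl_boxFourier` implements the partial Weyl element with.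
[cite: Rangarao1993, §3.1 (3.9)] [cite: MoeglinVignerasWaldspurger1987, Chap. 2 II.6] -/
theorem coe_boxEquivSB_fourierOpPi_refl_apply_glue (Θ : SchwartzBruhat (ι → K)) (η : ι₁ → K) (b : ι₂ → K) :
    ((boxEquivSB K e (fourierOpPi (ι := ι₁) μ hψ hm) (LinearEquiv.refl ℂ (SchwartzBruhat (ι₂ → K))) Θ : SchwartzBruhat (ι → K)) : (ι → K) → ℂ) (glue e η b) =
      ∫ u, ((ψ (u ⬝ᵥ η) : Circle) : ℂ) * (Θ : (ι → K) → ℂ) (glue e u b) ∂(Measure.pi fun _ : ι₁ => μ) := by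
  rw [boxEquivSB_refl_apply, coe_sumEndSB_id_apply_glue, LinearEquiv.coe_coe, coe_fourierOpPi, piFourierSB_apply]

/-- **THE PARTIAL FOURIER TRANSFORM OF THE `ι₂`-BLOCK READ POINTWISE (Rao's product measure)**:
`((1 ⊠ fourierOpPi μ) Θ)(a ⊔ η) = ∫ ψ(u ⬝ᵥ η) Θ(a ⊔ u) dμ^{⊗ι₂}(u)`. [cite: Rangarao1993, §3.1 (3.9)] [cite: MoeglinVignerasWaldspurger1987, Chap. 2 II.6] -/
theorem coe_boxEquivSB_refl_fourierOpPi_apply_glue (Θ : SchwartzBruhat (ι → K)) (a : ι₁ → K) (η : ι₂ → K) :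
    ((boxEquivSB K e (LinearEquiv.refl ℂ (SchwartzBruhat (ι₁ → K))) (fourierOpPi (ι := ι₂) μ hψ hm) Θ : SchwartzBruhat (ι → K)) : (ι → K) → ℂ) (glue e a η) =
      ∫ u, ((ψ (u ⬝ᵥ η) : Circle) : ℂ) * (Θ : (ι → K) → ℂ) (glue e a u) ∂(Measure.pi fun _ : ι₂ => μ) := by
  rw [← LinearEquiv.coe_coe, coe_boxEquivSB_eq_sumEndSB]
  rw [show ((LinearEquiv.refl ℂ (SchwartzBruhat (ι₁ → K)) : SchwartzBruhat (ι₁ → K) →ₗ[ℂ] SchwartzBruhat (ι₁ → K))) = LinearMap.id from rfl,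
    coe_sumEndSB_id_left_apply_glue, LinearEquiv.coe_coe, coe_fourierOpPi, piFourierSB_apply]

end PartialFourier

/-! ## §3 Fubini along the splitting: `∫_{K^ι} = ∫_{K^{ι₁}} ∫_{K^{ι₂}}` through `glue e`, and the product splitting -/

section Fubini

variable {K : Type*} [MeasurableSpace K] {ι₁ ι₂ ι : Type*} [Fintype ι₁] [Fintype ι₂] [Fintype ι] (e : ι₁ ⊕ ι₂ ≃ ι)
  (μ : Measure K) [SigmaFinite μ]

omit [Fintype ι₁] [Fintype ι₂] [Fintype ι] in
/-- gluing is the composite of Mathlib's measurable equivalences `sumPiEquivProdPi⁻¹` (pairs of blocks ↦ functions on `ι₁ ⊕ ι₂`) and `piCongrLeft e` (re-indexing).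
[folklore] -/
theorem glue_eq_piCongrLeft_sumPiEquivProdPi_symm (p : (ι₁ → K) × (ι₂ → K)) :
    glue e p.1 p.2 = MeasurableEquiv.piCongrLeft (fun _ : ι => K) e ((MeasurableEquiv.sumPiEquivProdPi fun _ : ι₁ ⊕ ι₂ => K).symm p) := by
  funext k
  rw [MeasurableEquiv.coe_piCongrLeft, Equiv.piCongrLeft_apply_eq_cast, cast_eq, MeasurableEquiv.coe_sumPiEquivProdPi_symm]
  simp only [glue]
  cases e.symm k <;> rfl

omit [Fintype ι₁] [Fintype ι₂] [Fintype ι] in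
/-- the composite measurable equivalence `piCongrLeft e ∘ sumPiEquivProdPi⁻¹ : K^{ι₁} × K^{ι₂} ≃ᵐ K^ι` IS gluing. [folklore] -/
theorem coe_sumPiEquivProdPi_symm_trans_piCongrLeft :
    ⇑((MeasurableEquiv.sumPiEquivProdPi fun _ : ι₁ ⊕ ι₂ => K).symm.trans (MeasurableEquiv.piCongrLeft (fun _ : ι => K) e)) =
      fun p : (ι₁ → K) × (ι₂ → K) => glue e p.1 p.2 :=
  funext fun p => (glue_eq_piCongrLeft_sumPiEquivProdPi_symm e p).symm

omit [Fintype ι₁] [Fintype ι₂] [Fintype ι] in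
/-- gluing is a measurable embedding (it is a measurable equivalence). [folklore] -/
theorem measurableEmbedding_glue : MeasurableEmbedding fun p : (ι₁ → K) × (ι₂ → K) => glue e p.1 p.2 := by
  rw [← coe_sumPiEquivProdPi_symm_trans_piCongrLeft e]
  exact MeasurableEquiv.measurableEmbedding _

/-- **`(a, b) ↦ a ⊔ b` IS MEASURE-PRESERVING** from `μ^{⊗ι₁} × μ^{⊗ι₂}` to `μ^{⊗ι}` (Mathlib `measurePreserving_piCongrLeft` ∘ `measurePreserving_sumPiEquivProdPi_symm`).
[cite: WeilBNT1967, Chap. VII §2, Prop. 2] -/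
theorem measurePreserving_glue :
    MeasurePreserving (fun p : (ι₁ → K) × (ι₂ → K) => glue e p.1 p.2)
      ((Measure.pi fun _ : ι₁ => μ).prod (Measure.pi fun _ : ι₂ => μ)) (Measure.pi fun _ : ι => μ) := by
  rw [← coe_sumPiEquivProdPi_symm_trans_piCongrLeft e]
  exact (measurePreserving_piCongrLeft (fun _ : ι => μ) e).comp (measurePreserving_sumPiEquivProdPi_symm (fun _ : ι₁ ⊕ ι₂ => μ))

variable {E : Type*} [NormedAddCommGroup E] [NormedSpace ℝ E]

/-- **CHANGE OF VARIABLES ALONG THE SPLITTING (no integrability needed)**: `∫_{K^{ι₁} × K^{ι₂}} F(a ⊔ b) = ∫_{K^ι} F`.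
[cite: WeilBNT1967, Chap. VII §2, Prop. 2] -/
theorem integral_comp_glue (F : (ι → K) → E) :
    ∫ p, F (glue e p.1 p.2) ∂((Measure.pi fun _ : ι₁ => μ).prod (Measure.pi fun _ : ι₂ => μ)) = ∫ v, F v ∂(Measure.pi fun _ : ι => μ) :=
  (measurePreserving_glue e μ).integral_comp (measurableEmbedding_glue e) F

omit [NormedSpace ℝ E] in
/-- integrability is the same on both sides of the splitting. [cite: WeilBNT1967, Chap. VII §2, Prop. 2] -/
theorem integrable_comp_glue_iff (F : (ι → K) → E) :
    Integrable (fun p : (ι₁ → K) × (ι₂ → K) => F (glue e p.1 p.2)) ((Measure.pi fun _ : ι₁ => μ).prod (Measure.pi fun _ : ι₂ => μ)) ↔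
      Integrable F (Measure.pi fun _ : ι => μ) :=
  (measurePreserving_glue e μ).integrable_comp_emb (measurableEmbedding_glue e)

/-- **FUBINI ALONG THE SPLITTING**: `∫_{K^ι} F = ∫_{K^{ι₁}} (∫_{K^{ι₂}} F(a ⊔ b) db) da` for integrable `F`. [cite: WeilBNT1967, Chap. VII §2, Prop. 2] -/
theorem integral_eq_integral_integral_glue {F : (ι → K) → E} (hF : Integrable F (Measure.pi fun _ : ι => μ)) :
    ∫ v, F v ∂(Measure.pi fun _ : ι => μ) = ∫ a, ∫ b, F (glue e a b) ∂(Measure.pi fun _ : ι₂ => μ) ∂(Measure.pi fun _ : ι₁ => μ) := by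
  rw [← integral_comp_glue e μ F]
  exact integral_prod (fun p : (ι₁ → K) × (ι₂ → K) => F (glue e p.1 p.2)) ((integrable_comp_glue_iff e μ F).mpr hF)

/-- **FUBINI ALONG THE SPLITTING, the other order**: `∫_{K^ι} F = ∫_{K^{ι₂}} (∫_{K^{ι₁}} F(a ⊔ b) da) db` for integrable `F`. [cite: WeilBNT1967, Chap. VII §2, Prop. 2] -/
theorem integral_eq_integral_integral_glue_symm {F : (ι → K) → E} (hF : Integrable F (Measure.pi fun _ : ι => μ)) :
    ∫ v, F v ∂(Measure.pi fun _ : ι => μ) = ∫ b, ∫ a, F (glue e a b) ∂(Measure.pi fun _ : ι₁ => μ) ∂(Measure.pi fun _ : ι₂ => μ) := by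
  rw [← integral_comp_glue e μ F]
  exact integral_prod_symm (fun p : (ι₁ → K) × (ι₂ → K) => F (glue e p.1 p.2)) ((integrable_comp_glue_iff e μ F).mpr hF)

/-- **THE PRODUCT SPLITTING (no integrability needed)**: `∫_{K^{ι₁} × K^{ι₂}} f₁(a) f₂(b)` computed along `glue`: for any scalar functions,
`∫_{K^ι} f₁(v|₁) f₂(v|₂) dμ^{⊗ι}(v) = (∫ f₁ dμ^{⊗ι₁}) (∫ f₂ dμ^{⊗ι₂})`. [cite: WeilBNT1967, Chap. VII §2, Prop. 2] -/
theorem integral_mul_resL_resR (f₁ : (ι₁ → K) → ℂ) (f₂ : (ι₂ → K) → ℂ) :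
    ∫ v, f₁ (resL e v) * f₂ (resR e v) ∂(Measure.pi fun _ : ι => μ) =
      (∫ a, f₁ a ∂(Measure.pi fun _ : ι₁ => μ)) * ∫ b, f₂ b ∂(Measure.pi fun _ : ι₂ => μ) := by
  rw [← integral_comp_glue e μ]
  simp only [resL_glue, resR_glue]
  exact integral_prod_mul f₁ f₂

end Fubini

/-! ## §4 The Schwartz–Bruhat instances (hypothesis-free) -/

section SchwartzBruhatFubini

variable (K : Type*) [Field K] [ValuativeRel K] [TopologicalSpace K] [IsNonarchimedeanLocalField K]
  [MeasurableSpace K] [BorelSpace K] (μ : Measure K) [μ.IsAddHaarMeasure]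
  {ι₁ ι₂ ι : Type*} [Fintype ι₁] [Fintype ι₂] [Fintype ι] (e : ι₁ ⊕ ι₂ ≃ ι)

/-- a Schwartz–Bruhat function on `K^ι` is integrable for the product Haar measure (locally constant with compact support against a Radon measure).
[cite: WeilBNT1967, Chap. VII §2, Prop. 2] -/
theorem integrable_schwartzBruhat_pi (Θ : SchwartzBruhat (ι → K)) : Integrable (Θ : (ι → K) → ℂ) (Measure.pi fun _ : ι => μ) := by
  haveI : SecondCountableTopology K := secondCountableTopology_localField K
  exact (continuous_schwartzBruhat Θ).integrable_of_hasCompactSupport (hasCompactSupport_schwartzBruhat Θ)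

/-- **FUBINI FOR SCHWARTZ–BRUHAT FUNCTIONS ALONG THE SPLITTING** (hypothesis-free): `∫_{K^ι} Θ = ∫_{K^{ι₁}} ∫_{K^{ι₂}} Θ(a ⊔ b) db da`.
[cite: WeilBNT1967, Chap. VII §2, Prop. 2] -/
theorem integral_schwartzBruhat_eq_integral_integral_glue (Θ : SchwartzBruhat (ι → K)) :
    ∫ v, (Θ : (ι → K) → ℂ) v ∂(Measure.pi fun _ : ι => μ) =
      ∫ a, ∫ b, (Θ : (ι → K) → ℂ) (glue e a b) ∂(Measure.pi fun _ : ι₂ => μ) ∂(Measure.pi fun _ : ι₁ => μ) := by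
  haveI : SecondCountableTopology K := secondCountableTopology_localField K
  exact integral_eq_integral_integral_glue e μ (integrable_schwartzBruhat_pi K μ Θ)

/-- the other order: `∫_{K^ι} Θ = ∫_{K^{ι₂}} ∫_{K^{ι₁}} Θ(a ⊔ b) da db`. [cite: WeilBNT1967, Chap. VII §2, Prop. 2] -/
theorem integral_schwartzBruhat_eq_integral_integral_glue_symm (Θ : SchwartzBruhat (ι → K)) :
    ∫ v, (Θ : (ι → K) → ℂ) v ∂(Measure.pi fun _ : ι => μ) =
      ∫ b, ∫ a, (Θ : (ι → K) → ℂ) (glue e a b) ∂(Measure.pi fun _ : ι₁ => μ) ∂(Measure.pi fun _ : ι₂ => μ) := by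
  haveI : SecondCountableTopology K := secondCountableTopology_localField K
  exact integral_eq_integral_integral_glue_symm e μ (integrable_schwartzBruhat_pi K μ Θ)

omit [BorelSpace K] in
/-- **THE INTEGRAL OF A PRODUCT `f₁ ⊠ f₂` SPLITS**: `∫_{K^ι} (f₁ ⊠ f₂) dμ^{⊗ι} = (∫ f₁ dμ^{⊗ι₁}) · (∫ f₂ dμ^{⊗ι₂})` — [A4]'s pure tensors `Φ_v = φ₁ ⊠ φ₂`
along `V′_v = V₁ ⊕ H`. [cite: WeilBNT1967, Chap. VII §2, Prop. 2] -/
theorem integral_boxSB (f₁ : SchwartzBruhat (ι₁ → K)) (f₂ : SchwartzBruhat (ι₂ → K)) :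
    ∫ v, (boxSB K e f₁ f₂ : (ι → K) → ℂ) v ∂(Measure.pi fun _ : ι => μ) =
      (∫ a, (f₁ : (ι₁ → K) → ℂ) a ∂(Measure.pi fun _ : ι₁ => μ)) * ∫ b, (f₂ : (ι₂ → K) → ℂ) b ∂(Measure.pi fun _ : ι₂ => μ) := by
  haveI : SecondCountableTopology K := secondCountableTopology_localField K
  rw [coe_boxSB]
  exact integral_mul_resL_resR e μ _ _

end SchwartzBruhatFubini

/-! ## §5 Transversal compatibility: a block Fourier transform `𝓕_{ι₁} ⊠ 1` on a pure tensor `φ₁ ⊠_τ φ₂` along ANOTHER splitting refining a common four-block -/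

section FourBlock

variable {X : Type*} {α₁ α₂ β₁ β₂ τ₁ τ₂ ι₁ ι₂ ι : Type*}
  (eA : α₁ ⊕ α₂ ≃ τ₁) (eB : β₁ ⊕ β₂ ≃ τ₂) (τ : τ₁ ⊕ τ₂ ≃ ι) (eI : α₁ ⊕ β₁ ≃ ι₁) (eJ : α₂ ⊕ β₂ ≃ ι₂) (e : ι₁ ⊕ ι₂ ≃ ι)
  (h₁ : ∀ a : α₁, e (Sum.inl (eI (Sum.inl a))) = τ (Sum.inl (eA (Sum.inl a))))
  (h₂ : ∀ b : β₁, e (Sum.inl (eI (Sum.inr b))) = τ (Sum.inr (eB (Sum.inl b))))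
  (h₃ : ∀ a : α₂, e (Sum.inr (eJ (Sum.inl a))) = τ (Sum.inl (eA (Sum.inr a))))
  (h₄ : ∀ b : β₂, e (Sum.inr (eJ (Sum.inr b))) = τ (Sum.inr (eB (Sum.inr b))))

include h₁ h₂ h₃ h₄ in
/-- **THE FOUR-BLOCK IDENTITY**: when the Fourier splitting `e : ι₁ ⊕ ι₂ ≃ ι` (`ι₁ = α₁ ⊔ β₁`, `ι₂ = α₂ ⊔ β₂`) and the box splitting `τ : τ₁ ⊕ τ₂ ≃ ι` (`τ₁ = α₁ ⊔ α₂`,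
`τ₂ = β₁ ⊔ β₂`) refine a common four-block decomposition (`h₁`–`h₄`), `(a₁ ⊔ b₁) ⊔_e (a₂ ⊔ b₂) = (a₁ ⊔ a₂) ⊔_τ (b₁ ⊔ b₂)`. [folklore] -/
theorem glue_glue_eq_glue_glue (a₁ : α₁ → X) (a₂ : α₂ → X) (b₁ : β₁ → X) (b₂ : β₂ → X) :
    glue e (glue eI a₁ b₁) (glue eJ a₂ b₂) = glue τ (glue eA a₁ a₂) (glue eB b₁ b₂) := by
  funext k
  obtain ⟨x, rfl⟩ := e.surjective k
  rcases x with i | j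
  · obtain ⟨y, rfl⟩ := eI.surjective i
    rcases y with a | b
    · conv_rhs => rw [h₁]
      simp only [glue, Equiv.symm_apply_apply, Sum.elim_inl]
    · conv_rhs => rw [h₂]
      simp only [glue, Equiv.symm_apply_apply, Sum.elim_inl, Sum.elim_inr]
  · obtain ⟨y, rfl⟩ := eJ.surjective j
    rcases y with a | b
    · conv_rhs => rw [h₃]
      simp only [glue, Equiv.symm_apply_apply, Sum.elim_inl, Sum.elim_inr]
    · conv_rhs => rw [h₄]
      simp only [glue, Equiv.symm_apply_apply, Sum.elim_inr]

end FourBlock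

section DotProduct

variable {K : Type*} [CommSemiring K] {ι₁ ι₂ ι : Type*} [Fintype ι₁] [Fintype ι₂] [Fintype ι] (e : ι₁ ⊕ ι₂ ≃ ι)

/-- the dot product splits along a coordinate splitting: `(x ⊔ y) ⬝ᵥ (x′ ⊔ y′) = x ⬝ᵥ x′ + y ⬝ᵥ y′`. [folklore] -/
theorem glue_dotProduct_glue (x x' : ι₁ → K) (y y' : ι₂ → K) : glue e x y ⬝ᵥ glue e x' y' = x ⬝ᵥ x' + y ⬝ᵥ y' := by
  simp only [dotProduct]
  rw [← e.sum_comp, Fintype.sum_sum_type]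
  simp only [glue, Equiv.symm_apply_apply, Sum.elim_inl, Sum.elim_inr]

end DotProduct

section Transversal

variable (K : Type*) [Field K] [ValuativeRel K] [TopologicalSpace K] [IsNonarchimedeanLocalField K]
  [MeasurableSpace K] [BorelSpace K] (μ : Measure K) [μ.IsAddHaarMeasure]
  {ψ : AddChar K Circle} (hψ : ψ.IsContinuousNontrivial) {m : ℤ} (hm : ψ.HasConductorExp m)
  {α₁ α₂ β₁ β₂ τ₁ τ₂ ι₁ ι₂ ι : Type*} [Fintype α₁] [Fintype α₂] [Fintype β₁] [Fintype β₂] [Fintype τ₁] [Fintype τ₂] [Fintype ι₁] [Fintype ι₂] [Fintype ι]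
  (eA : α₁ ⊕ α₂ ≃ τ₁) (eB : β₁ ⊕ β₂ ≃ τ₂) (τ : τ₁ ⊕ τ₂ ≃ ι) (eI : α₁ ⊕ β₁ ≃ ι₁) (eJ : α₂ ⊕ β₂ ≃ ι₂) (e : ι₁ ⊕ ι₂ ≃ ι)

/-- **TRANSVERSAL COMPATIBILITY OF A BLOCK FOURIER TRANSFORM WITH PURE TENSORS** ([A4]'s `Φ_v = φ₁ ⊠ φ₂` along `V′_v = V₁ ⊕ H` versus [A1]'s `e₂`-block): if the Fourier
block `ι₁ = α₁ ⊔ β₁` and the box factors `τ₁ = α₁ ⊔ α₂`, `τ₂ = β₁ ⊔ β₂` refine a common four-block decomposition of `ι` (`h₁`–`h₄`), then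
`(𝓕_{ι₁} ⊠_e 1)(φ₁ ⊠_τ φ₂) = ((𝓕_{α₁} ⊠_{eA} 1) φ₁) ⊠_τ ((𝓕_{β₁} ⊠_{eB} 1) φ₂)` — the character `ψ(u ⬝ᵥ η)` and the measure `μ^{⊗ι₁}` both split along
`eI : α₁ ⊕ β₁ ≃ ι₁` (§3), and each factor is read by the slice formula (§2). [cite: WeilBNT1967, Chap. VII §2, Prop. 2] [cite: MoeglinVignerasWaldspurger1987, Chap. 2 II.6] -/
theorem boxEquivSB_fourierOpPi_refl_boxSB_of_fourBlock
    (h₁ : ∀ a : α₁, e (Sum.inl (eI (Sum.inl a))) = τ (Sum.inl (eA (Sum.inl a))))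
    (h₂ : ∀ b : β₁, e (Sum.inl (eI (Sum.inr b))) = τ (Sum.inr (eB (Sum.inl b))))
    (h₃ : ∀ a : α₂, e (Sum.inr (eJ (Sum.inl a))) = τ (Sum.inl (eA (Sum.inr a))))
    (h₄ : ∀ b : β₂, e (Sum.inr (eJ (Sum.inr b))) = τ (Sum.inr (eB (Sum.inr b))))
    (φ₁ : SchwartzBruhat (τ₁ → K)) (φ₂ : SchwartzBruhat (τ₂ → K)) :
    boxEquivSB K e (fourierOpPi (ι := ι₁) μ hψ hm) (LinearEquiv.refl ℂ (SchwartzBruhat (ι₂ → K))) (boxSB K τ φ₁ φ₂) =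
      boxSB K τ (boxEquivSB K eA (fourierOpPi (ι := α₁) μ hψ hm) (LinearEquiv.refl ℂ (SchwartzBruhat (α₂ → K))) φ₁)
        (boxEquivSB K eB (fourierOpPi (ι := β₁) μ hψ hm) (LinearEquiv.refl ℂ (SchwartzBruhat (β₂ → K))) φ₂) := by
  haveI : SecondCountableTopology K := secondCountableTopology_localField K
  apply Subtype.ext
  funext v
  -- write `v` in the four-block coordinates: `v = (a₁ ⊔ b₁) ⊔_e (a₂ ⊔ b₂) = (a₁ ⊔ a₂) ⊔_τ (b₁ ⊔ b₂)`
  have hv : v = glue e (glue eI (resL eI (resL e v)) (resR eI (resL e v))) (glue eJ (resL eJ (resR e v)) (resR eJ (resR e v))) := by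
    rw [glue_resL_resR, glue_resL_resR, glue_resL_resR]
  rw [hv]
  set a₁ := resL eI (resL e v)
  set b₁ := resR eI (resL e v)
  set a₂ := resL eJ (resR e v)
  set b₂ := resR eJ (resR e v)
  rw [coe_boxEquivSB_fourierOpPi_refl_apply_glue, glue_glue_eq_glue_glue eA eB τ eI eJ e h₁ h₂ h₃ h₄, boxSB_apply_glue,
    coe_boxEquivSB_fourierOpPi_refl_apply_glue, coe_boxEquivSB_fourierOpPi_refl_apply_glue,
    ← integral_comp_glue eI μ, ← integral_prod_mul]
  refine integral_congr_ae (Filter.Eventually.of_forall fun p => ?_)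
  simp only [glue_glue_eq_glue_glue eA eB τ eI eJ e h₁ h₂ h₃ h₄, boxSB_apply_glue, glue_dotProduct_glue, AddChar.map_add_eq_mul, Circle.coe_mul]
  ring

end Transversal

end Summit.HodgeConjecture.HodgeConjecture.Cruxes.HLiu418.K2LiuLocalPiPartialFourierSplitting

end
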